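import Mathlib
import HarnessLib
import Literature.Analysis.FluidPDE.SuitableWeak
import Summits.NavierStokesRegularity.NavierStokesRegularity.Theorems.QuarterJoltRung

/-!
# Route QuarterJolt — crux `NoTerminalJolt` (stmt-NavierStokesRegularity-26463), LEAD line
# `regular_split` rev 3: the RATE-γ CARICATURE — in the kinematic caricature family,
# «terminal jolt ⟺ Type-I rate»

Seat ns-ntj-p1 g2 (LEAD of the crux; `--supports 26463 --as helper`; calibration rung for the two
open stubs of `Cruxes/NoTerminalJolt/Lines/regular_split.lean` rev 3, in the manner of the route's
BC5 rung `Theorems/QuarterJoltRung.lean`, p611876).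

The rung `QuarterJoltRung` decides the jolt functional `D(t) = (√(T−t))⁻¹ ∫‖u(t) − u(T)‖²` for the
SELF-SIMILAR-rate caricature `u(t,x) = λU(λx)`, `λ = (T−t)^{−1/2}`: `D ≡ ∫‖U‖²`. Here the same is
done for EVERY collapse rate `λ(t) = (T−t)^{−γ}`, `γ > 0`, realised WITHOUT a new definition as the
time-reparametrised caricature `t ↦ ssCaricature T U (T − (T−t)^{2γ})` (extinct terminal value `0`;
its sup-norm is `(T−t)^{−γ} · sup‖U‖`, so it has the Type-I rate `IsTypeIBlowup` iff `γ ≤ 1/2` for a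
bounded nonzero profile — `isTypeIBlowup_rateCaricature`, `not_isTypeIBlowup_rateCaricature`):

* `joltFunctional_rateCaricature` — `D(t) = (T−t)^{γ − 1/2} · ∫‖U‖²` for `t < T`;
* `tendsto_joltFunctional_rateCaricature` — `γ > 1/2` (TYPE-II collapse rate) ⇒ `D → 0`: a profile
  collapsing FASTER than self-similarly carries `L²`-mass² `(T−t)^{γ} ≪ √(T−t)` and does NOT jolt;
* `not_tendsto_joltFunctional_rateCaricature` — `γ ≤ 1/2` and `∫‖U‖² ≠ 0` ⇒ `D ↛ 0` (for `γ = 1/2`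
  the rung's constant, for `γ < 1/2` divergence).

READING for the reshaped line (rev 3: `stub_noTypeIBlowup` = stmt-1217 ∣ `stub_typeIIJolt`): in the
caricature family the conclusion of the Type-II stub HOLDS (Type-II-rate collapse is invisible to the
`√(T−t)`-normalised `L²` distance), while the Type-I-rate member is exactly the jolting one — matching
the Type-I terminal jolt law `NoTerminalJolt.typeI_terminalJoltLaw` (p629148) on the NS side. So the
content of the crux `NoTerminalJolt` beyond stmt-1217 is the claim that a genuine non-Type-I blow-up
sheds no `√(T−t)`-sized `L²` remainder — a statement about the RADIATION, not the bubble.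

HONEST FRAMING: kinematic caricatures, not Navier–Stokes solutions (they are not in the frame of the
crux); nothing here bears on the truth of `NoTerminalJolt`, stmt-1217, stmt-0056 or Navier–Stokes
regularity — all OPEN. No summit statement is proved here. [folklore]
-/

noncomputable section

-- the summit and its single sub-problem share the name (CONVENTIONS §1), as in every Theorems file
set_option linter.dupNamespace false

namespace Summit.NavierStokesRegularity.NavierStokesRegularity.Theorems.QuarterJoltRung

open MeasureTheory Filter Set Topology
open Literature.Analysis.FluidPDE

/-- The `L²`-mass² of the self-similar caricature at a time `s < T` is `√(T−s) · ∫‖U‖²` (read off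
the rung `joltFunctional_ssCaricature`). -/
theorem integral_norm_sq_ssCaricature {T s : ℝ} (hs : s < T)
    (U : EuclideanSpace ℝ (Fin 3) → EuclideanSpace ℝ (Fin 3)) :
    ∫ x, ‖ssCaricature T U s x‖ ^ 2 = Real.sqrt (T - s) * ∫ x, ‖U x‖ ^ 2 := by
  have h := joltFunctional_ssCaricature hs U
  have hpos : 0 < Real.sqrt (T - s) := Real.sqrt_pos.2 (sub_pos.2 hs)
  simp only [ssCaricature_top, sub_zero] at h
  rw [← h, ← mul_assoc, mul_inv_cancel₀ hpos.ne', one_mul]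

/-- For `γ > 0` the reparametrised time `T − (T−t)^{2γ}` is `T` at `t = T` (extinct terminal value). -/
theorem rateTime_top {T γ : ℝ} (hγ : 0 < γ) : T - (T - T) ^ (2 * γ) = T := by
  rw [sub_self, Real.zero_rpow (by positivity), sub_zero]

/-- For `γ > 0` and `t < T` the reparametrised time lies before `T`, at distance `(T−t)^{2γ}`. -/
theorem rateTime_lt {T γ t : ℝ} (ht : t < T) : T - (T - t) ^ (2 * γ) < T :=
  sub_lt_self _ (Real.rpow_pos_of_pos (sub_pos.2 ht) _)

/-- **The jolt functional of the rate-`γ` caricature**: for `t < T`,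
`(√(T−t))⁻¹ ∫‖u(t) − u(T)‖² = (T−t)^{γ − 1/2} · ∫‖U‖²`, where
`u(t) = ssCaricature T U (T − (T−t)^{2γ}) = (T−t)^{−γ} U((T−t)^{−γ} ·)` and `u(T) = 0`. -/
theorem joltFunctional_rateCaricature {T γ t : ℝ} (hγ : 0 < γ) (ht : t < T)
    (U : EuclideanSpace ℝ (Fin 3) → EuclideanSpace ℝ (Fin 3)) :
    (Real.sqrt (T - t))⁻¹ *
        ∫ x, ‖ssCaricature T U (T - (T - t) ^ (2 * γ)) x -
          ssCaricature T U (T - (T - T) ^ (2 * γ)) x‖ ^ 2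
      = (T - t) ^ (γ - 1 / 2) * ∫ x, ‖U x‖ ^ 2 := by
  have hTt : 0 < T - t := sub_pos.2 ht
  simp only [rateTime_top hγ, ssCaricature_top, sub_zero]
  rw [integral_norm_sq_ssCaricature (rateTime_lt ht) U, ← mul_assoc]
  congr 1
  have h1 : T - (T - (T - t) ^ (2 * γ)) = (T - t) ^ (2 * γ) := by ring
  rw [h1, Real.sqrt_eq_rpow, Real.sqrt_eq_rpow, ← Real.rpow_mul hTt.le,
    ← Real.rpow_neg hTt.le, ← Real.rpow_add hTt]
  congr 1
  ring

/-- **Type-II-rate caricatures do NOT jolt**: for `γ > 1/2` the jolt functional of the rate-`γ`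
caricature tends to `0` as `t ↑ T` — whatever the profile (`∫‖U‖²` is a fixed real number). -/
theorem tendsto_joltFunctional_rateCaricature {T γ : ℝ} (hγ : 1 / 2 < γ)
    (U : EuclideanSpace ℝ (Fin 3) → EuclideanSpace ℝ (Fin 3)) :
    Tendsto (fun t : ℝ => (Real.sqrt (T - t))⁻¹ *
        ∫ x, ‖ssCaricature T U (T - (T - t) ^ (2 * γ)) x -
          ssCaricature T U (T - (T - T) ^ (2 * γ)) x‖ ^ 2) (𝓝[<] T) (𝓝 0) := by
  have hγ0 : 0 < γ := by linarith
  have hp : 0 < γ - 1 / 2 := by linarith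
  have hev : (fun t : ℝ => (Real.sqrt (T - t))⁻¹ *
        ∫ x, ‖ssCaricature T U (T - (T - t) ^ (2 * γ)) x -
          ssCaricature T U (T - (T - T) ^ (2 * γ)) x‖ ^ 2)
      =ᶠ[𝓝[<] T] fun t => (T - t) ^ (γ - 1 / 2) * ∫ x, ‖U x‖ ^ 2 := by
    filter_upwards [self_mem_nhdsWithin] with t ht
    exact joltFunctional_rateCaricature hγ0 ht U
  refine Tendsto.congr' hev.symm ?_
  have h1 : Tendsto (fun t : ℝ => T - t) (𝓝[<] T) (𝓝 0) := by
    have h : Tendsto (fun t : ℝ => T - t) (𝓝 T) (𝓝 (T - T)) :=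
      (continuous_const.sub continuous_id).tendsto T
    rw [sub_self] at h
    exact h.mono_left nhdsWithin_le_nhds
  have h2 : Tendsto (fun t : ℝ => (T - t) ^ (γ - 1 / 2)) (𝓝[<] T) (𝓝 0) := by
    have h := h1.rpow_const (p := γ - 1 / 2) (Or.inr hp.le)
    rwa [Real.zero_rpow hp.ne'] at h
  simpa using h2.mul_const (∫ x, ‖U x‖ ^ 2)

/-- **Type-I-rate (and slower) caricatures JOLT**: for `0 < γ ≤ 1/2` and a profile with
`∫‖U‖² ≠ 0` the jolt functional does not tend to `0` (on `T − 1 ≤ t < T` it is `≥ ∫‖U‖² > 0`). For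
`γ = 1/2` this is the rung `ssCaricature_jolts`. -/
theorem not_tendsto_joltFunctional_rateCaricature {T γ : ℝ} (hγ0 : 0 < γ) (hγ : γ ≤ 1 / 2)
    (U : EuclideanSpace ℝ (Fin 3) → EuclideanSpace ℝ (Fin 3)) (hU : ∫ x, ‖U x‖ ^ 2 ≠ 0) :
    ¬ Tendsto (fun t : ℝ => (Real.sqrt (T - t))⁻¹ *
        ∫ x, ‖ssCaricature T U (T - (T - t) ^ (2 * γ)) x -
          ssCaricature T U (T - (T - T) ^ (2 * γ)) x‖ ^ 2) (𝓝[<] T) (𝓝 0) := by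
  have hU0 : 0 < ∫ x, ‖U x‖ ^ 2 :=
    lt_of_le_of_ne (integral_nonneg fun _ => sq_nonneg _) (Ne.symm hU)
  intro h
  -- eventually `D(t) < ∫‖U‖²`, but on `(T-1, T)` one has `D(t) ≥ ∫‖U‖²`
  have h1 : ∀ᶠ t in 𝓝[<] T, (Real.sqrt (T - t))⁻¹ *
        ∫ x, ‖ssCaricature T U (T - (T - t) ^ (2 * γ)) x -
          ssCaricature T U (T - (T - T) ^ (2 * γ)) x‖ ^ 2 < ∫ x, ‖U x‖ ^ 2 :=
    h.eventually (Iio_mem_nhds hU0)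
  have h2 : ∀ᶠ t in 𝓝[<] T, t ∈ Ioo (T - 1) T := Ioo_mem_nhdsLT (by linarith)
  obtain ⟨t, ht1, ht2⟩ := (h1.and h2).exists
  have hTt : 0 < T - t := sub_pos.2 ht2.2
  rw [joltFunctional_rateCaricature hγ0 ht2.2 U] at ht1
  have hge : 1 ≤ (T - t) ^ (γ - 1 / 2) :=
    Real.one_le_rpow_of_pos_of_le_one_of_nonpos hTt (by linarith [ht2.1]) (by linarith)
  have : ∫ x, ‖U x‖ ^ 2 ≤ (T - t) ^ (γ - 1 / 2) * ∫ x, ‖U x‖ ^ 2 :=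
    le_mul_of_one_le_left hU0.le hge
  linarith

/-- **The caricature decides the jolt exactly by rate**: for `γ > 0` and `∫‖U‖² ≠ 0`, the rate-`γ`
caricature has no terminal jolt iff `γ > 1/2`. -/
theorem tendsto_joltFunctional_rateCaricature_iff {T γ : ℝ} (hγ0 : 0 < γ)
    (U : EuclideanSpace ℝ (Fin 3) → EuclideanSpace ℝ (Fin 3)) (hU : ∫ x, ‖U x‖ ^ 2 ≠ 0) :
    Tendsto (fun t : ℝ => (Real.sqrt (T - t))⁻¹ *
        ∫ x, ‖ssCaricature T U (T - (T - t) ^ (2 * γ)) x -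
          ssCaricature T U (T - (T - T) ^ (2 * γ)) x‖ ^ 2) (𝓝[<] T) (𝓝 0) ↔ 1 / 2 < γ := by
  refine ⟨fun h => ?_, fun h => tendsto_joltFunctional_rateCaricature h U⟩
  by_contra hle
  exact not_tendsto_joltFunctional_rateCaricature hγ0 (not_lt.1 hle) U hU h

/-! ### The sup-rate of the caricature: Type I iff `γ ≤ 1/2` -/

/-- Pointwise size of the rate-`γ` caricature before `T`:
`‖u(t,x)‖ = (T−t)^{−γ} ‖U((T−t)^{−γ} x)‖`. -/
theorem norm_rateCaricature {T γ t : ℝ} (ht : t < T)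
    (U : EuclideanSpace ℝ (Fin 3) → EuclideanSpace ℝ (Fin 3)) (x : EuclideanSpace ℝ (Fin 3)) :
    ‖ssCaricature T U (T - (T - t) ^ (2 * γ)) x‖ =
      (T - t) ^ (-γ) * ‖U (((T - t) ^ (-γ)) • x)‖ := by
  have hTt : 0 < T - t := sub_pos.2 ht
  have h1 : T - (T - (T - t) ^ (2 * γ)) = (T - t) ^ (2 * γ) := by ring
  have hl : (Real.sqrt ((T - t) ^ (2 * γ)))⁻¹ = (T - t) ^ (-γ) := by
    rw [Real.sqrt_eq_rpow, ← Real.rpow_mul hTt.le, ← Real.rpow_neg hTt.le]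
    congr 1
    ring
  unfold ssCaricature
  rw [if_pos (rateTime_lt ht), h1, hl, norm_smul, Real.norm_of_nonneg (Real.rpow_nonneg hTt.le _)]

/-- **A Type-I-rate caricature with bounded profile is Type I** (`IsTypeIBlowup`): for
`0 < γ ≤ 1/2` and `‖U‖ ≤ M`, `‖u(t,x)‖ ≤ M/√(T−t)` on `T − 1 ≤ t < T`. -/
theorem isTypeIBlowup_rateCaricature {T γ M : ℝ} (hγ0 : 0 < γ) (hγ : γ ≤ 1 / 2)
    (U : EuclideanSpace ℝ (Fin 3) → EuclideanSpace ℝ (Fin 3)) (hM : ∀ y, ‖U y‖ ≤ M) :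
    IsTypeIBlowup (fun t x => ssCaricature T U (T - (T - t) ^ (2 * γ)) x) T := by
  have hM0 : 0 ≤ M := (norm_nonneg _).trans (hM 0)
  refine ⟨M, ?_⟩
  filter_upwards [Ioo_mem_nhdsLT (show T - 1 < T by linarith)] with t ht
  intro x
  have hTt : 0 < T - t := sub_pos.2 ht.2
  rw [norm_rateCaricature ht.2 U x, div_eq_mul_inv, Real.sqrt_eq_rpow, ← Real.rpow_neg hTt.le,
    mul_comm]
  refine mul_le_mul (hM _) ?_ (Real.rpow_nonneg hTt.le _) hM0
  exact Real.rpow_le_rpow_of_exponent_ge hTt (by linarith [ht.1]) (by linarith)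

/-- **A Type-II-rate caricature with nonzero profile is NOT Type I**: for `γ > 1/2` and `U x₁ ≠ 0`,
along the collapsing point `(T−t)^{γ} x₁` the size `(T−t)^{−γ}‖U x₁‖` beats every `C/√(T−t)`. -/
theorem not_isTypeIBlowup_rateCaricature {T γ : ℝ} (hγ : 1 / 2 < γ)
    (U : EuclideanSpace ℝ (Fin 3) → EuclideanSpace ℝ (Fin 3)) {x₁ : EuclideanSpace ℝ (Fin 3)}
    (hx₁ : U x₁ ≠ 0) :
    ¬ IsTypeIBlowup (fun t x => ssCaricature T U (T - (T - t) ^ (2 * γ)) x) T := by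
  have hγ0 : 0 < γ := by linarith
  rintro ⟨C, hC⟩
  have hU : 0 < ‖U x₁‖ := norm_pos_iff.2 hx₁
  -- the excess exponent
  have hp : 0 < γ - 1 / 2 := by linarith
  -- `(T - t)^{γ - 1/2} → 0`, so eventually `(T-t)^{γ-1/2} * (C + 1) < ‖U x₁‖`
  have h1 : Tendsto (fun t : ℝ => T - t) (𝓝[<] T) (𝓝 0) := by
    have h : Tendsto (fun t : ℝ => T - t) (𝓝 T) (𝓝 (T - T)) :=
      (continuous_const.sub continuous_id).tendsto T
    rw [sub_self] at h
    exact h.mono_left nhdsWithin_le_nhds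
  have h2 : Tendsto (fun t : ℝ => (T - t) ^ (γ - 1 / 2) * (|C| + 1)) (𝓝[<] T) (𝓝 0) := by
    have h := h1.rpow_const (p := γ - 1 / 2) (Or.inr hp.le)
    rw [Real.zero_rpow hp.ne'] at h
    simpa using h.mul_const (|C| + 1)
  have h3 : ∀ᶠ t in 𝓝[<] T, (T - t) ^ (γ - 1 / 2) * (|C| + 1) < ‖U x₁‖ :=
    h2.eventually (Iio_mem_nhds hU)
  have h4 : ∀ᶠ t in 𝓝[<] T, t < T := self_mem_nhdsWithin
  obtain ⟨t, hCt, hsmall, htT⟩ := (hC.and (h3.and h4)).exists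
  have hTt : 0 < T - t := sub_pos.2 htT
  -- evaluate the Type-I bound at the collapsing point
  have hx := hCt (((T - t) ^ γ) • x₁)
  rw [norm_rateCaricature htT U, smul_smul, ← Real.rpow_add hTt, neg_add_cancel,
    Real.rpow_zero, one_smul] at hx
  -- `hx : (T-t)^{-γ} ‖U x₁‖ ≤ C / √(T-t)`; multiply by `(T-t)^{γ}`... compare with `hsmall`
  have hsq : Real.sqrt (T - t) = (T - t) ^ (1 / 2 : ℝ) := Real.sqrt_eq_rpow _
  have hsq0 : 0 < Real.sqrt (T - t) := Real.sqrt_pos.2 hTt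
  have key : ‖U x₁‖ ≤ (T - t) ^ (γ - 1 / 2) * C := by
    have e : (T - t) ^ (γ - 1 / 2) * C = (T - t) ^ γ * (C / Real.sqrt (T - t)) := by
      rw [hsq, Real.rpow_sub hTt, div_eq_mul_inv, div_eq_mul_inv]
      ring
    rw [e]
    have h' := mul_le_mul_of_nonneg_left hx (Real.rpow_nonneg hTt.le γ)
    rwa [← mul_assoc, ← Real.rpow_add hTt, add_neg_cancel, Real.rpow_zero, one_mul] at h'
  have hC' : (T - t) ^ (γ - 1 / 2) * C ≤ (T - t) ^ (γ - 1 / 2) * (|C| + 1) :=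
    mul_le_mul_of_nonneg_left (by linarith [le_abs_self C]) (Real.rpow_nonneg hTt.le _)
  linarith
end Summit.NavierStokesRegularity.NavierStokesRegularity.Theorems.QuarterJoltRung

end
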